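import Mathlib
import HarnessLib
import Literature.MathematicalPhysics.StatisticalMechanics.RenormalisationMapBallABKM

/-!
# The renormalisation map takes the `r`-ball into the admissible activities of the next scale
# ([ABKM19] Lemma 6.4 + Theorem 6.8: `S_k(H,K) ∈ M(𝓟_{k+1}^c)` with finite `‖·‖_{k+1}^{(A)}`), torus data

For the concrete data of [ABKM19] on `(ℤ/L^N)^d` (step `k → k+1`, `‖H‖_{k,0} ≤ r`, `K` factorising with
`K(∅) = 1`, `C^{r₀}`, local, translation invariant, `‖K‖_k^{(A)} ≤ r`), the image `S(H,K) = nextKStep D H K`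
restricted to connected `(k+1)`-polymers is a member of `activitySpace P (k+1)` — the `F (k+1)`-valued
step of the fine-tuning engine (`RGFlow.IsRGStepQ`):

* **`contDiff_nextKStep_abkm`** — `S(H,K)(U, ·)` is `C^{r₀}` for every `U` (from the decomposition
  `S = blockPart + Σ₁ + Σ₂ᴸ + Σ₃ + Σ₄` and the smoothness of its summands; `U = ∅` gives the constant `1`);
* **`transInv_nextKStep_abkm`** — Lemma 6.4 (1) for the concrete data;
* **`isGaugeLocal_nextKStep_abkm`** — Lemma 6.4 (2)–(3) for the concrete gauges `T_{k+1}^{U*}`;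
* **`restrictConn_nextKStep_mem_activitySpace`** — membership of `restrictConn (L^{k+1}) (S(H,K))` in
  `activitySpace P (k+1)` on the `r`-ball (finite norm by `weakNormLE_nextKStep_abkm_ball`).

Everything is proved; no named fact.

## References
* S. Adams, S. Buchholz, R. Kotecký, S. Müller, arXiv:1910.13564, Lemma 6.4, Theorem 6.8, Ch. 12 (12.2)
  [AdamsBuchholzKoteckyMuller2019].
-/

noncomputable section

namespace Literature.MathematicalPhysics.StatisticalMechanics.GradientRG

open scoped BigOperators Classical
open Finset MeasureTheory
open Literature.MathematicalPhysics.StatisticalMechanics.TorusPolymer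
  (IsPolymer blocks polys bprod blockOf thicken reblock boxCorner mem_polys mem_blocks numBlocks isPolymer_blockOf
    card_blocks_eq_numBlocks blocks_blockOf empty_mem_polys closure mem_blockOf_self)
open Literature.Barriers.CriticalPhenomena.LongRangePhi4.Polymer (IsConn components)
open Literature.MathematicalPhysics.StatisticalMechanics.GradientFRD (iterDiff)
open Literature.MathematicalPhysics.QuantumFieldTheory

variable {d M : ℕ} [NeZero M]

/-! ## `S(H,K)(U, ·)` is `C^{r₀}` -/

set_option maxHeartbeats 400000 in
/-- **`S(H,K)(U, ·) ∈ C^{r₀}` for every `U`** (module docstring).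
[cite: AdamsBuchholzKoteckyMuller2019, Theorem 6.8 (smoothness of S_k), Lemma 9.6] -/
theorem contDiff_nextKStep_abkm {L N Mord R n p r₀ : ℕ} {θbar lam μ δ₁ δ₀ A𝒫 h A : ℝ}
    {𝒞 : ℕ → (Fin d → ZMod M) → ℝ} (hd : 3 ≤ d) (hLodd : Odd L) (hL : 2 ^ (d + 3) + 16 * R ≤ L)
    (hM : M = L ^ N) {k : ℕ} (hkN : k + 1 ≤ N) (hp : d / 2 + 2 ≤ p) (hpM : p + d ≤ Mord) (hMR : Mord ≤ R)
    (hθbar : 0 < θbar) (hlam : 0 < lam)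
    (hB : AbkmWeightBounds L N Mord R n θbar lam μ δ₁ δ₀ A𝒫 𝒞
      (abkmWeightData L N Mord R θbar (schedDelta δ₀ δ₁ N) 𝒞))
    (hδ₀ : 0 < δ₀) (hδ₁ : 0 < δ₁) (hh : 0 < h) (hh0 : hZeroSq d R δ₀ δ₁ ≤ h ^ 2) (hA1 : 1 ≤ A)
    (D : StepData d M) (hDs : D.s = L ^ k) (hDL : D.L = L) (hD𝒞 : D.𝒞 = 𝒞 (k + 1))
    {x₀ : Fin d → ZMod M} (hB₀ : D.B₀ = blockOf (L ^ k) x₀) (hc₀ : D.c₀ = boxCorner (L ^ k) (starRad R L d k) x₀)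
    {H : RelevantHamiltonian ℂ d} (hH : hamNorm (fieldWt h (L : ℝ) d k) ((L : ℝ) ^ k) (L ^ (d * k)) H ≤ 1 / 8)
    {K : Finset (Fin d → ZMod M) → ((Fin d → ZMod M) → ℝ) → ℂ} {C : ℝ} (hC : 0 ≤ C)
    (hK : WeakNormLE (abkmNormParams L N Mord R p r₀ h θbar A (schedDelta δ₀ δ₁ N) 𝒞) k K C)
    (hKfac : Factorises (L ^ k) K) (hK0 : ∀ φ, K ∅ φ = 1) (hKd : ∀ Y, ContDiff ℝ r₀ (K Y))
    (hKloc : ∀ Y, IsPolymer (L ^ k) Y → IsConn Y → IsGaugeLocal ((abkmNormParams L N Mord R p r₀ h θbar A (schedDelta δ₀ δ₁ N) 𝒞).gauge k Y) (K Y))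
    (U : Finset (Fin d → ZMod M)) : ContDiff ℝ r₀ (nextKStep D H K U) := by
  by_cases hUe : U = ∅
  · subst hUe
    have : nextKStep D H K ∅ = fun _ => (1 : ℂ) := funext (nextKStep_empty D H hK0)
    rw [this]; exact contDiff_const
  have hUne : U.Nonempty := Finset.nonempty_iff_ne_empty.2 hUe
  have hd2 : 2 ≤ d := by omega
  have hp1 : d / 2 + 1 ≤ p := by omega
  have hpR : p ≤ R := by omega
  have hMord : d / 2 + 1 ≤ Mord := by omega
  have hA0 : 0 < A := by linarith
  have hk1 : k + 1 ≤ N + 1 := by omega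
  have hUk : ∀ X ∈ ((polys (L ^ k) univ).filter (fun X => reblock (L ^ k) (L * L ^ k) X = U)), IsPolymer (L ^ k) X :=
    fun X hX => (mem_polys.1 (mem_filter.1 hX).1).2
  have hblk : ∀ B ∈ blockPartIndex D U, ∃ y, B = blockOf (L ^ k) y := fun B hB' => by
    have hBb := blockPartIndex_subset_blocks D U hB'
    rw [hDs] at hBb
    obtain ⟨y, -, rfl⟩ := mem_blocks.1 hBb
    exact ⟨y, rfl⟩
  have hF0d : ContDiff ℝ r₀ (fun φ => blockPart D K U φ) :=
    contDiff_blockPart_abkm hθbar hlam hB hLodd hM hk1 hA0 D hDs hD𝒞 hC hK hKd hKloc U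
  have hF1d : ContDiff ℝ r₀ (fun φ => ∑ B ∈ blockPartIndex D U,
        ((bprod (L ^ k) (fun B' => expNegH (nextH D H K) B' φ) (U \ B) *
              bprod (L ^ k) (fun B' => expNegH (-(nextH D H K)) B' φ) (B \ U) - 1) * blockTerm D K B φ +
          bprod (L ^ k) (fun B' => expNegH (nextH D H K) B' φ) (U \ B) *
              bprod (L ^ k) (fun B' => expNegH (-(nextH D H K)) B' φ) (B \ U) *
            (fluctDefect (𝒞 (k + 1)) H B φ +
              (expNegH (stepOpA (gradCov (𝒞 (k + 1))) H) B φ - 1) * (1 - Complex.exp (-(eval (opB D K) B φ))) -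
              (Complex.exp (-(eval (opB D K) B φ)) - 1 + eval (opB D K) B φ)) +
          bprod (L ^ k) (fun B' => expNegH (nextH D H K) B' φ) (U \ B) *
              bprod (L ^ k) (fun B' => expNegH (-(nextH D H K)) B' φ) (B \ U) *
            fluct (𝒞 (k + 1)) (fun ψ => ∑ Y ∈ ((polys (L ^ k) B).erase B).erase ∅,
              bprod (L ^ k) (fun B' => expNegH H B' ψ - 1) (B \ Y) * K Y ψ) φ)) := by
    refine ContDiff.sum fun B hB' => ?_
    obtain ⟨y, rfl⟩ := hblk B hB'
    exact contDiff_blockSummand_abkm (p := p) (r₀ := r₀) (A := A) hd2 hθbar hlam hB hLodd hM hkN hδ₀ hδ₁ hh hh0 hMord hp1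
      hA0 D hD𝒞 y (nextH D H K) hH hC hK hKd hKloc U
  have hF2d : ContDiff ℝ r₀ (fun φ => ∑ X ∈ largePartIndex (L ^ k) L U,
        bprod (L ^ k) (fun B => expNegH (nextH D H K) B φ) (U \ X) *
            bprod (L ^ k) (fun B => expNegH (-(nextH D H K)) B φ) (X \ U) *
          (fluct (𝒞 (k + 1)) (polyP2 (L ^ k) H K X) φ + bprod (L ^ k) (fun B => 1 - expNegH (nextH D H K) B φ) X)) := by
    refine ContDiff.sum fun X hX => ?_
    obtain ⟨hXp, -, -, -⟩ := mem_largePartIndex.1 hX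
    exact contDiff_reblockTop_abkm hd2 hLodd hM hkN hp1 hMord hθbar hlam hB hδ₀ hδ₁ hh hh0 hA0 hXp (nextH D H K) hH hC
      hK hKfac hK0 hKd hKloc U
  have hF3d : ContDiff ℝ r₀ (fun φ => ∑ X ∈ ((polys (L ^ k) univ).filter (fun X => reblock (L ^ k) (L * L ^ k) X = U)).filter
          (fun X => ¬ IsConn X),
        bprod (L ^ k) (fun B => expNegH (nextH D H K) B φ) (U \ X) *
            bprod (L ^ k) (fun B => expNegH (-(nextH D H K)) B φ) (X \ U) *
          (fluct (𝒞 (k + 1)) (polyP2 (L ^ k) H K X) φ + bprod (L ^ k) (fun B => 1 - expNegH (nextH D H K) B φ) X)) := by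
    refine ContDiff.sum fun X hX => ?_
    have hXp := hUk X (mem_filter.1 hX).1
    exact contDiff_reblockTop_abkm hd2 hLodd hM hkN hp1 hMord hθbar hlam hB hδ₀ hδ₁ hh hh0 hA0 hXp (nextH D H K) hH hC
      hK hKfac hK0 hKd hKloc U
  have hF4d : ContDiff ℝ r₀ (fun φ => ∑ X ∈ (polys (L ^ k) univ).filter (fun X => reblock (L ^ k) (L * L ^ k) X = U),
        ∑ X₁ ∈ ((polys (L ^ k) X).erase X).erase ∅,
          bprod (L ^ k) (fun B => expNegH (nextH D H K) B φ) (U \ X) *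
            bprod (L ^ k) (fun B => expNegH (-(nextH D H K)) B φ) (X \ U) *
            (bprod (L ^ k) (fun B => 1 - expNegH (nextH D H K) B φ) X₁ *
              fluct (𝒞 (k + 1)) (polyP2 (L ^ k) H K (X \ X₁)) φ)) := by
    refine ContDiff.sum fun X hX => ContDiff.sum fun X₁ hX₁ => ?_
    have hXp := hUk X hX
    have hX₁p : X₁ ∈ polys (L ^ k) X := mem_of_mem_erase (mem_of_mem_erase hX₁)
    exact contDiff_reblockSub_abkm hd2 hLodd hM hkN hp1 hMord hθbar hlam hB hδ₀ hδ₁ hh hh0 hA0 hXp hX₁p (nextH D H K) hH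
      hC hK hKfac hK0 hKd hKloc U
  have hdec := nextKStep_eq_blockPart_add_remainders_abkm (p := p) (r₀ := r₀) (A := A) hd2 hLodd hL hM hkN hp1 hpR hMord
    hθbar hlam hB hδ₀ hδ₁ hh hh0 hA0 D hDs hDL hD𝒞 hB₀ hc₀ hH hC hK hKfac hK0 hKd hKloc hUne
  have hfun : nextKStep D H K U = (fun φ => blockPart D K U φ) + (fun φ => ∑ B ∈ blockPartIndex D U,
        ((bprod (L ^ k) (fun B' => expNegH (nextH D H K) B' φ) (U \ B) *
              bprod (L ^ k) (fun B' => expNegH (-(nextH D H K)) B' φ) (B \ U) - 1) * blockTerm D K B φ +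
          bprod (L ^ k) (fun B' => expNegH (nextH D H K) B' φ) (U \ B) *
              bprod (L ^ k) (fun B' => expNegH (-(nextH D H K)) B' φ) (B \ U) *
            (fluctDefect (𝒞 (k + 1)) H B φ +
              (expNegH (stepOpA (gradCov (𝒞 (k + 1))) H) B φ - 1) * (1 - Complex.exp (-(eval (opB D K) B φ))) -
              (Complex.exp (-(eval (opB D K) B φ)) - 1 + eval (opB D K) B φ)) +
          bprod (L ^ k) (fun B' => expNegH (nextH D H K) B' φ) (U \ B) *
              bprod (L ^ k) (fun B' => expNegH (-(nextH D H K)) B' φ) (B \ U) *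
            fluct (𝒞 (k + 1)) (fun ψ => ∑ Y ∈ ((polys (L ^ k) B).erase B).erase ∅,
              bprod (L ^ k) (fun B' => expNegH H B' ψ - 1) (B \ Y) * K Y ψ) φ)) + (fun φ => ∑ X ∈ largePartIndex (L ^ k) L U,
        bprod (L ^ k) (fun B => expNegH (nextH D H K) B φ) (U \ X) *
            bprod (L ^ k) (fun B => expNegH (-(nextH D H K)) B φ) (X \ U) *
          (fluct (𝒞 (k + 1)) (polyP2 (L ^ k) H K X) φ + bprod (L ^ k) (fun B => 1 - expNegH (nextH D H K) B φ) X)) + (fun φ => ∑ X ∈ ((polys (L ^ k) univ).filter (fun X => reblock (L ^ k) (L * L ^ k) X = U)).filter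
          (fun X => ¬ IsConn X),
        bprod (L ^ k) (fun B => expNegH (nextH D H K) B φ) (U \ X) *
            bprod (L ^ k) (fun B => expNegH (-(nextH D H K)) B φ) (X \ U) *
          (fluct (𝒞 (k + 1)) (polyP2 (L ^ k) H K X) φ + bprod (L ^ k) (fun B => 1 - expNegH (nextH D H K) B φ) X)) + (fun φ => ∑ X ∈ (polys (L ^ k) univ).filter (fun X => reblock (L ^ k) (L * L ^ k) X = U),
        ∑ X₁ ∈ ((polys (L ^ k) X).erase X).erase ∅,
          bprod (L ^ k) (fun B => expNegH (nextH D H K) B φ) (U \ X) *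
            bprod (L ^ k) (fun B => expNegH (-(nextH D H K)) B φ) (X \ U) *
            (bprod (L ^ k) (fun B => 1 - expNegH (nextH D H K) B φ) X₁ *
              fluct (𝒞 (k + 1)) (polyP2 (L ^ k) H K (X \ X₁)) φ)) := by
    funext ψ
    simp only [Pi.add_apply]
    exact hdec ψ
  rw [hfun]
  exact (((hF0d.add hF1d).add hF2d).add hF3d).add hF4d

/-! ## Lemma 6.4 (1)–(3) for the concrete data -/

/-- **Lemma 6.4 (1), torus data**: `S(H,K)` is translation invariant on scale `k+1` when `K` is on
scale `k`. [cite: AdamsBuchholzKoteckyMuller2019, Lemma 6.4 (1)] -/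
theorem transInv_nextKStep_abkm {L N Mord R n : ℕ} {θbar lam μ δ₁ δ₀ A𝒫 : ℝ}
    {𝒞 : ℕ → (Fin d → ZMod M) → ℝ} (hLodd : Odd L) (hL : 2 ^ (d + 3) + 16 * R ≤ L)
    (hM : M = L ^ N) {k : ℕ} (hkN : k + 1 ≤ N)
    (hB : AbkmWeightBounds L N Mord R n θbar lam μ δ₁ δ₀ A𝒫 𝒞
      (abkmWeightData L N Mord R θbar (schedDelta δ₀ δ₁ N) 𝒞))
    (D : StepData d M) (hDs : D.s = L ^ k) (hDL : D.L = L) (hD𝒞 : D.𝒞 = 𝒞 (k + 1))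
    (H : RelevantHamiltonian ℂ d) {K : Finset (Fin d → ZMod M) → ((Fin d → ZMod M) → ℝ) → ℂ}
    (hKt : TransInv (L ^ k) K) : TransInv (L ^ (k + 1)) (nextKStep D H K) := by
  have hk1 : k + 1 ≤ N + 1 := by omega
  have h8 : 8 ≤ 2 ^ (d + 3) := by
    calc 8 = 2 ^ 3 := by norm_num
      _ ≤ 2 ^ (d + 3) := Nat.pow_le_pow_right (by norm_num) (by omega)
  have h2d : 2 ^ d ≤ L := by
    have : 2 ^ d ≤ 2 ^ (d + 3) := Nat.pow_le_pow_right (by norm_num) (by omega)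
    omega
  have hMst : M = (D.L * D.s) * L ^ (N - (k + 1)) := by
    rw [hDL, hDs, ← pow_succ', ← pow_add, Nat.add_sub_cancel' (show k + 1 ≤ N from hkN)]; exact hM
  have hL2 : 2 ^ d * D.s ≤ D.L * D.s := by rw [hDL]; exact Nat.mul_le_mul_right _ h2d
  have hC : (Matrix.circulant D.𝒞).PosSemidef := by rw [hD𝒞]; exact posSemidef_circulant_abkm hB hk1
  have hs : Odd D.s := by rw [hDs]; exact hLodd.pow
  have hL' : Odd D.L := by rw [hDL]; exact hLodd
  have hK' : TransInv D.s K := by rw [hDs]; exact hKt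
  have h := transInv_nextKStep D hMst hs hL' hLodd.pow hL2 hC H hK'
  rw [hDL, hDs, ← pow_succ'] at h
  exact h

/-- **Lemma 6.4 (2)–(3), torus data**: `S(H,K)(U, ·)` is local for the gauge `T_{k+1}^{U*}` of the concrete
parameters on every `(k+1)`-polymer `U`, when `K` factorises with `K(∅) = 1` and is local on connected
`k`-polymers. [cite: AdamsBuchholzKoteckyMuller2019, Lemma 6.4 (2)–(3)] -/
theorem isGaugeLocal_nextKStep_abkm {L N Mord R p r₀ : ℕ} {h θbar A δ₀ δ₁ : ℝ}
    {𝒞 : ℕ → (Fin d → ZMod M) → ℝ} (hd : 3 ≤ d) (hLodd : Odd L) (hL : 2 ^ (d + 3) + 16 * R ≤ L)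
    (hM : M = L ^ N) {k : ℕ} (hkN : k + 1 ≤ N) (hp : d / 2 + 2 ≤ p) (hh : 0 < h)
    (D : StepData d M) (hDs : D.s = L ^ k) (hDL : D.L = L)
    (H : RelevantHamiltonian ℂ d) {K : Finset (Fin d → ZMod M) → ((Fin d → ZMod M) → ℝ) → ℂ}
    (hKfac : Factorises (L ^ k) K) (hK0 : ∀ φ, K ∅ φ = 1)
    (hKloc : ∀ Y, IsPolymer (L ^ k) Y → IsConn Y → IsGaugeLocal ((abkmNormParams L N Mord R p r₀ h θbar A (schedDelta δ₀ δ₁ N) 𝒞).gauge k Y) (K Y))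
    (U : Finset (Fin d → ZMod M)) :
    IsGaugeLocal ((abkmNormParams L N Mord R p r₀ h θbar A (schedDelta δ₀ δ₁ N) 𝒞).gauge (k + 1) U) (nextKStep D H K U) := by
  have h8 : 8 ≤ 2 ^ (d + 3) := by
    calc 8 = 2 ^ 3 := by norm_num
      _ ≤ 2 ^ (d + 3) := Nat.pow_le_pow_right (by norm_num) (by omega)
  have hL4 : 4 ≤ L := by omega
  have hL0 : (0 : ℝ) < L := by exact_mod_cast hLodd.pos
  have h2dR : 2 ^ d + R ≤ L := by
    have : 2 ^ d ≤ 2 ^ (d + 3) := Nat.pow_le_pow_right (by norm_num) (by omega)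
    omega
  have hMo : Odd M := by rw [hM]; exact hLodd.pow
  have hsodd : Odd (L ^ k) := hLodd.pow
  obtain ⟨t, ht⟩ : ∃ t, N = k + t := ⟨N - k, by omega⟩
  have hMt : M = L ^ k * L ^ t := by rw [← pow_add, ← ht]; exact hM
  have htodd : Odd (L ^ t) := hLodd.pow
  -- gauge weights of the two scales
  have h𝔥k : 0 < fieldWt h (L : ℝ) d k := fieldWt_pos hh hL0 d k
  have h𝔥' : 0 < fieldWt h (L : ℝ) d (k + 1) := fieldWt_pos hh hL0 d (k + 1)
  have h𝔥le : fieldWt h (L : ℝ) d (k + 1) ≤ fieldWt h (L : ℝ) d k := by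
    rw [fieldWt_succ_nat hLodd.pos d k]
    exact mul_le_of_le_one_left h𝔥k.le (scaleRatio_le_one hd hL4)
  have hRk : (0 : ℝ) < (L : ℝ) ^ k := by positivity
  have hRle : (L : ℝ) ^ k ≤ (L : ℝ) ^ (k + 1) :=
    pow_le_pow_right₀ (by exact_mod_cast hLodd.pos) (Nat.le_succ k)
  -- locality of `K` on all `k`-polymers, for the scale-`(k+1)` weights
  have hKall : ∀ Y, IsPolymer (L ^ k) Y →
      IsGaugeLocal (fieldGauge (fieldWt h (L : ℝ) d k) ((L : ℝ) ^ k) p (thicken (starRad R L d k) Y)) (K Y) := by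
    intro Y hY
    have hKloc' : ∀ Y, IsPolymer (L ^ k) Y → IsConn Y →
        IsGaugeLocal (fieldGauge (fieldWt h (L : ℝ) d k) ((L : ℝ) ^ k) p (thicken (starRad R L d k) Y)) (K Y) :=
      fun Y hY hc => by rw [← abkmNormParams_gauge L N Mord R p r₀ h θbar A (schedDelta δ₀ δ₁ N) 𝒞 k Y]; exact hKloc Y hY hc
    exact isGaugeLocal_of_factorises_polys hMt hsodd htodd hKfac hK0 hKloc' hY
  have hK' : ∀ Y, IsPolymer D.s Y →
      IsGaugeLocal (fieldGauge (fieldWt h (L : ℝ) d (k + 1)) ((L : ℝ) ^ (k + 1)) p (thicken (starRad R L d k) Y)) (K Y) := by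
    intro Y hY
    rw [hDs] at hY
    exact (hKall Y hY).of_norm_le fun ξ => norm_fieldGauge_mono_weights h𝔥' h𝔥le hRk hRle _ _ ξ
  have hMst : M = D.s * L ^ t := by rw [hDs]; exact hMt
  have hs : Odd D.s := by rw [hDs]; exact hsodd
  have hL' : Odd D.L := by rw [hDL]; exact hLodd
  have hr : starRad R L d k + (2 ^ d - 1) * D.s ≤ starRad R L d (k + 1) := by
    rw [hDs]; exact starRad_add_le_succ h2dR k
  rw [abkmNormParams_gauge]
  exact isGaugeLocal_nextKStep D hMst hs htodd hL' h𝔥'.ne' (pow_pos hL0 (k + 1)).ne' (by omega : d / 2 + 1 ≤ p)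
    (starRad_le_succ h2dR k) hr H hK' U

/-! ## Membership in `activitySpace P (k+1)` on the `r`-ball -/

set_option maxHeartbeats 400000 in
/-- **`restrictConn (L^{k+1}) (S(H,K)) ∈ activitySpace P (k+1)` on the `r`-ball** (module docstring).
[cite: AdamsBuchholzKoteckyMuller2019, Theorem 6.8 / Ch. 12 (12.2)] -/
theorem restrictConn_nextKStep_mem_activitySpace {L N Mord R n p r₀ : ℕ} {θbar lam μ δ₁ δ₀ A𝒫 h A : ℝ}
    {𝒞 : ℕ → (Fin d → ZMod M) → ℝ} (hd : 3 ≤ d) (hn : 2 ≤ n) (hLodd : Odd L) (hL : 2 ^ (d + 3) + 16 * R ≤ L)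
    (hR2 : 2 ≤ R) (hM : M = L ^ N) {k : ℕ} (hkN : k + 1 ≤ N)
    (hp : d / 2 + 2 ≤ p) (hpM : p + d ≤ Mord) (hMR : Mord ≤ R) (hr₀ : 3 ≤ r₀)
    (hθbar : 0 < θbar) (hlam : 0 < lam)
    (hB : AbkmWeightBounds L N Mord R n θbar lam μ δ₁ δ₀ A𝒫 𝒞
      (abkmWeightData L N Mord R θbar (schedDelta δ₀ δ₁ N) 𝒞))
    (hδ₀ : 0 < δ₀) (hδ₁ : 0 < δ₁) (hh : 0 < h) (hh0 : hZeroSq d R δ₀ δ₁ ≤ h ^ 2)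
    {Cα : (Fin d → ℕ) → ℝ}
    (hCα : ∀ j, 1 ≤ j → j ≤ N + 1 → ∀ θ' : Fin d → ℕ, ∑ i, θ' i ≤ n →
      ∀ x, |iterDiff θ' (𝒞 j) x| ≤ Cα θ' / (L : ℝ) ^ ((j - 1) * (d - 2 + ∑ i, θ' i)))
    (hh2 : secondDiffConst Cα ≤ h ^ 2) (hA𝒫 : 0 ≤ A𝒫) (hA1 : 1 ≤ A)
    (hA𝒫A : A𝒫 ≤ A)
    (hsmall : (2 : ℝ) ^ (L ^ d) * (A𝒫 * A ^ (-(1 - (1 + 1 / ((2 * (2 ^ d + 1) + 6 : ℝ) ^ d))⁻¹) : ℝ)) ≤ 1)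
    (D : StepData d M) (hDs : D.s = L ^ k) (hDL : D.L = L) (hD𝒞 : D.𝒞 = 𝒞 (k + 1))
    {x₀ : Fin d → ZMod M} (hB₀ : D.B₀ = blockOf (L ^ k) x₀) (hc₀ : D.c₀ = boxCorner (L ^ k) (starRad R L d k) x₀)
    {H : RelevantHamiltonian ℂ d} {r : ℝ}
    (hH : hamNorm (fieldWt h (L : ℝ) d k) ((L : ℝ) ^ k) (L ^ (d * k)) H ≤ r) (hr : r ≤ 1 / 64)
    {K : Finset (Fin d → ZMod M) → ((Fin d → ZMod M) → ℝ) → ℂ}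
    (hK : WeakNormLE (abkmNormParams L N Mord R p r₀ h θbar A (schedDelta δ₀ δ₁ N) 𝒞) k K r)
    (hKfac : Factorises (L ^ k) K) (hK0 : ∀ φ, K ∅ φ = 1)
    (hKd : ∀ Y, ContDiff ℝ r₀ (K Y))
    (hKloc : ∀ Y, IsPolymer (L ^ k) Y → IsConn Y → IsGaugeLocal ((abkmNormParams L N Mord R p r₀ h θbar A (schedDelta δ₀ δ₁ N) 𝒞).gauge k Y) (K Y))
    (hKt : TransInv (L ^ k) K)
    (hv : vABKM d R A A𝒫 r ≤ 1 / 64) (hωA : omegaABKM d R A A𝒫 r * A ^ 2 ≤ 1)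
    (hc3A : (kappaABKM d R A A𝒫 r) ^ (L ^ d) * ((2 * (2 * (kappaABKM d R A A𝒫 r) * max 1 A𝒫)) ^ ((2 ^ (d + 1) + 2) ^ d * L ^ d) * (4 : ℝ) ^ ((2 ^ (d + 1) + 2) ^ d * L ^ d)) ≤ A ^ ((1 + 1 / ((2 * (2 ^ d + 1) + 6 : ℝ) ^ d)) - 1 : ℝ))
    (hc2A : (kappaABKM d R A A𝒫 r) ^ (L ^ d) * ((2 * (kappaABKM d R A A𝒫 r) * max 1 A𝒫) ^ ((2 ^ (d + 1) + 2) ^ d * L ^ d) * (2 : ℝ) ^ ((2 ^ (d + 1) + 2) ^ d * L ^ d)) ≤ A ^ ((1 + 1 / ((2 * (2 ^ d + 1) + 6 : ℝ) ^ d)) - 1 : ℝ)) :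
    restrictConn (L ^ (k + 1)) (nextKStep D H K) ∈ activitySpace (abkmNormParams L N Mord R p r₀ h θbar A (schedDelta δ₀ δ₁ N) 𝒞) (k + 1) := by
  have hL0 : (0 : ℝ) < L := by exact_mod_cast hLodd.pos
  have h𝔥 : 0 < fieldWt h (L : ℝ) d k := fieldWt_pos hh hL0 d k
  have hRk : (0 : ℝ) < (L : ℝ) ^ k := by positivity
  have hr0 : 0 ≤ r := (hamNorm_nonneg h𝔥.le hRk.le _ _).trans hH
  have hH8 : hamNorm (fieldWt h (L : ℝ) d k) ((L : ℝ) ^ k) (L ^ (d * k)) H ≤ 1 / 8 := by linarith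
  obtain ⟨t, ht⟩ : ∃ t, N = (k + 1) + t := ⟨N - (k + 1), by omega⟩
  have hMt : M = (abkmNormParams L N Mord R p r₀ h θbar A (schedDelta δ₀ δ₁ N) 𝒞).L ^ (k + 1) * L ^ t := by
    show M = L ^ (k + 1) * L ^ t
    rw [← pow_add, ← ht]; exact hM
  have hbound := weakNormLE_nextKStep_abkm_ball hd hn hLodd hL hR2 hM hkN hp hpM hMR hr₀ hθbar hlam hB hδ₀ hδ₁ hh hh0 hCα
    hh2 hA𝒫 hA1 hA𝒫A hsmall D hDs hDL hD𝒞 hB₀ hc₀ hH hr hK hKfac hK0 hKd hKloc hKt hv hωA hc3A hc2A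
  exact restrictConn_mem_activitySpace hMt hLodd.pow hLodd.pow
    (fun U _ _ => contDiff_nextKStep_abkm hd hLodd hL hM hkN hp hpM hMR hθbar hlam hB hδ₀ hδ₁ hh hh0 hA1 D hDs hDL hD𝒞
      hB₀ hc₀ hH8 hr0 hK hKfac hK0 hKd hKloc U)
    (fun U _ _ => isGaugeLocal_nextKStep_abkm hd hLodd hL hM hkN hp hh D hDs hDL H hKfac hK0 hKloc U)
    (transInv_nextKStep_abkm hLodd hL hM hkN hB D hDs hDL hD𝒞 H hKt) hbound

end Literature.MathematicalPhysics.StatisticalMechanics.GradientRG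

end
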